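import Summits.AtomisticToContinuum.BoseEinsteinCondensation.Theorems.PuffFloor.Negative.PuffFloorFalseForNearMinimisers
import HarnessLib

/-!
# No structure-factor floor over all modes survives for near-minimisers when its tolerated deficit is `o(1/k)` (crux `HardCoreExtension`, stmt-AtomisticToContinuum-11786)

Standing adversary of crux `HardCoreExtension` (route `BECConjugateDomination`), gen 3. The general
principle behind `QuadraticFloorNearMinFalse.lean` (this seat) and
`PuffFloor.Negative.puffFloor_false_for_nearMinimisers` (the `PuffFloor` disprover), typed once and
for all for the class-blind lines of the crux (`second-moment-floor-class-blind` ≈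
`third-law-current-floor`), which must state their floors for NEAR-minimisers because hard cores have
no exact `C¹` minimiser:

* `freeGas_nearMinimiser_floor_violated` — let `f : ℝ → ℝ` be ANY candidate floor with
  `(1 − f(k))·k → 0` as `k → ∞` (hypothesis `hf`: for every `η > 0` some `K` with
  `(1 − f k)·k ≤ η` for `k ≥ K`). Then for the FREE gas on the torus of ANY side `L > 0`, every
  `N = n + 1 ≥ 2` and every slack `δ > 0` there are a real, pointwise positive `δ`-near-minimiser `Ψ`
  (`E₀^per = 0`) and a mode `m ≠ 0` with `S_m(Ψ) < f(kn m)`. Witness: the anti-correlated state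
  `PuffFloor.Negative.witnessState` (`S_m = 1 − εn`, energy `≤ 2ε²N³k²`) at the first lattice mode
  `k = (2π/L)j` beyond `max(K, 1, η/(εn))`, with `η² ≤ δ n²/(8N³)` and `ε² ≤ δ/(8N³(K'² + (2π/L)²))`,
  `ε ≤ 1/(2N²)`: the floor's deficit at `k` is `≤ η/k < εn` while the modulation costs `< δ`.
* Corollaries in the lever shapes: `deficit_quadratic` (`f = k²/(k²+c)`, deficit `≤ c/k`) and
  `deficit_sqrt` (`f = k/√(k²+c)`, deficit `≤ c/(2k)`) verify `hf` for the two printed floors, so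
  `Ideator3.QuadraticFloor` and the near-minimiser `PuffFloor` both fall under the principle; any
  repair must CAP the floor away from `1` (e.g. `min(½, ·)`, consistent at the free gas by
  `QuadraticFloorCappedFreeGas.lean`) or restrict the modes to a window fixed before `δ`.

No Theses statement is asserted positively. All `[folklore]`.
-/

noncomputable section

namespace Summit.AtomisticToContinuum.BoseEinsteinCondensation.Theorems.HardCoreExtension.Negative

open Literature.MathematicalPhysics.QuantumManyBody.BoseGas MeasureTheory Filter
open Summit.AtomisticToContinuum.BoseEinsteinCondensation.Theorems.PuffFloor.Negative
open scoped ENNReal NNReal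

/-- `max` squared is at most the sum of squares. [folklore] -/
theorem max_sq_le_add_sq (a b : ℝ) : max a b ^ 2 ≤ a ^ 2 + b ^ 2 := by
  rcases le_total a b with h | h
  · rw [max_eq_right h]; nlinarith [sq_nonneg a]
  · rw [max_eq_left h]; nlinarith [sq_nonneg b]

/-- **The UV junk principle.** For any floor `f` with `(1 − f(k))·k → 0`, the free gas has, at every
side `L > 0`, every `N = n+1 ≥ 2` and every slack `δ > 0`, a real positive `δ`-near-minimiser and a
mode at which `S_m < f(kn m)`. [folklore] -/
theorem freeGas_nearMinimiser_floor_violated (f : ℝ → ℝ)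
    (hf : ∀ η : ℝ, 0 < η → ∃ K : ℝ, ∀ k : ℝ, K ≤ k → (1 - f k) * k ≤ η)
    {n : ℕ} (hn : 1 ≤ n) {L : ℝ} (hL : 0 < L) {δ : ℝ≥0∞} (hδ : 0 < δ) :
    ∃ Ψ : PeriodicTrialState (n + 1) L,
      periodicEnergy (0 : ℝ → ℝ≥0∞) Ψ ≤ periodicGroundStateEnergy (0 : ℝ → ℝ≥0∞) (n + 1) L + δ ∧
      (∀ X, Ψ.ψ X = (‖Ψ.ψ X‖ : ℂ)) ∧ (∀ X, Ψ.ψ X ≠ 0) ∧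
      ∃ m : Fin 3 → ℤ, m ≠ 0 ∧
        ((n : ℝ) + 1)⁻¹ * ∫ X in cellN (n + 1) L,
            ‖∑ j : Fin (n + 1), cellWave L m (X j)‖ ^ 2 * ‖Ψ.ψ X‖ ^ 2 <
          f ‖(2 * Real.pi / L) • latticeVec 1 m‖ := by
  have hn' : (1 : ℝ) ≤ n := by exact_mod_cast hn
  have hn0 : (0 : ℝ) < n := by linarith
  -- a real energy budget `δr` below `δ`
  obtain ⟨δr, hδr, hδr'⟩ : ∃ δr : ℝ, 0 < δr ∧ ENNReal.ofReal δr ≤ δ := by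
    rcases eq_or_ne δ ⊤ with htop | htop
    · exact ⟨1, one_pos, htop ▸ le_top⟩
    · exact ⟨δ.toReal, ENNReal.toReal_pos hδ.ne' htop, ENNReal.ofReal_toReal_le⟩
  -- constants (opaque)
  obtain ⟨Nr, hNr⟩ : ∃ Nr : ℝ, Nr = (n : ℝ) + 1 := ⟨_, rfl⟩
  have hNr0 : 0 < Nr := by rw [hNr]; positivity
  have hNr1 : 1 ≤ Nr := by rw [hNr]; linarith
  obtain ⟨c₀, hc₀⟩ : ∃ c₀ : ℝ, c₀ = 2 * Real.pi / L := ⟨_, rfl⟩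
  have hc₀0 : 0 < c₀ := by rw [hc₀]; positivity
  -- `η`: the tolerance fed to `hf`, with `4 N³ η² / n² ≤ δr / 2`
  obtain ⟨η, hηdef⟩ : ∃ η : ℝ, η = min 1 (δr * n ^ 2 / (8 * Nr ^ 3)) := ⟨_, rfl⟩
  have hη0 : 0 < η := by rw [hηdef]; exact lt_min one_pos (by positivity)
  have hη1 : η ≤ 1 := by rw [hηdef]; exact min_le_left _ _
  have hη2 : η ≤ δr * n ^ 2 / (8 * Nr ^ 3) := by rw [hηdef]; exact min_le_right _ _
  have hηsq : 4 * Nr ^ 3 * η ^ 2 / (n : ℝ) ^ 2 ≤ δr / 2 := by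
    have h1 : η ^ 2 ≤ η := by nlinarith
    have h2 : η ^ 2 ≤ δr * n ^ 2 / (8 * Nr ^ 3) := h1.trans hη2
    rw [div_le_iff₀ (by positivity)]
    rw [le_div_iff₀ (by positivity)] at h2
    nlinarith
  -- `K` from the tail hypothesis, `K' = max K 1`
  obtain ⟨K, hK⟩ := hf η hη0
  obtain ⟨K', hK'⟩ : ∃ K' : ℝ, K' = max K 1 := ⟨_, rfl⟩
  have hK'1 : 1 ≤ K' := by rw [hK']; exact le_max_right _ _
  have hK'0 : 0 < K' := by linarith
  have hKK' : K ≤ K' := by rw [hK']; exact le_max_left _ _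
  -- `ε`: the amplitude, `ε ≤ 1/(2N²)` and `4 ε² N³ (K'² + c₀²) ≤ δr / 2`
  obtain ⟨B, hB⟩ : ∃ B : ℝ, B = 8 * Nr ^ 3 * (K' ^ 2 + c₀ ^ 2) := ⟨_, rfl⟩
  have hB0 : 0 < B := by rw [hB]; positivity
  obtain ⟨ε, hεdef⟩ : ∃ ε : ℝ, ε = min (1 / (2 * Nr ^ 2)) (min 1 (δr / B)) := ⟨_, rfl⟩
  have hε0 : 0 < ε := by
    rw [hεdef]; exact lt_min (by positivity) (lt_min one_pos (by positivity))
  have hεN : ε ≤ 1 / (2 * Nr ^ 2) := by rw [hεdef]; exact min_le_left _ _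
  have hε1 : ε ≤ 1 := by rw [hεdef]; exact (min_le_right _ _).trans (min_le_left _ _)
  have hεB : ε ≤ δr / B := by rw [hεdef]; exact (min_le_right _ _).trans (min_le_right _ _)
  have hεsq : 4 * ε ^ 2 * Nr ^ 3 * (K' ^ 2 + c₀ ^ 2) ≤ δr / 2 := by
    have h1 : ε ^ 2 ≤ ε := by nlinarith
    have h2 : ε ^ 2 ≤ δr / B := h1.trans hεB
    rw [le_div_iff₀ hB0, hB] at h2
    nlinarith
  have hεa : ε * ((((n + 1 : ℕ) : ℝ)) ^ 2 - ((n + 1 : ℕ) : ℝ)) ≤ 1 / 2 := by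
    push_cast
    rw [← hNr]
    have h1 : ε * (Nr ^ 2 - Nr) ≤ ε * Nr ^ 2 :=
      mul_le_mul_of_nonneg_left (by nlinarith) hε0.le
    have h2 : ε * Nr ^ 2 ≤ 1 / 2 := by
      rw [le_div_iff₀ (by positivity)] at hεN
      linarith
    exact h1.trans h2
  -- the dip `d = ε n` and the threshold `k* = max K' (η / d)`
  obtain ⟨d, hd⟩ : ∃ d : ℝ, d = ε * n := ⟨_, rfl⟩
  have hd0 : 0 < d := by rw [hd]; positivity
  obtain ⟨ks, hks⟩ : ∃ ks : ℝ, ks = max K' (η / d) := ⟨_, rfl⟩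
  have hks0 : 0 < ks := lt_of_lt_of_le hK'0 (by rw [hks]; exact le_max_left _ _)
  -- the mode `j = ⌊k*/c₀⌋ + 1`, `k = c₀ j ∈ (k*, k* + c₀]`
  obtain ⟨j, hj⟩ : ∃ j : ℕ, j = ⌊ks / c₀⌋₊ + 1 := ⟨_, rfl⟩
  have hj0 : 0 < j := by rw [hj]; exact Nat.succ_pos _
  obtain ⟨m, hmdef⟩ : ∃ m : Fin 3 → ℤ, m = Pi.single (0 : Fin 3) ((j : ℕ) : ℤ) := ⟨_, rfl⟩
  have hm : m ≠ 0 := by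
    intro h0
    have := congr_fun h0 0
    rw [hmdef, Pi.single_eq_same, Pi.zero_apply] at this
    exact hj0.ne' (by exact_mod_cast this)
  have hkn : ‖((2 * Real.pi / L) • latticeVec 1 m)‖ = c₀ * j := by
    rw [hmdef, hc₀]
    exact norm_smul_latticeVec_single (by positivity) j
  obtain ⟨k, hkdef⟩ : ∃ k : ℝ, k = c₀ * j := ⟨_, rfl⟩
  rw [← hkdef] at hkn
  have hjlow : ks / c₀ < j := by rw [hj]; push_cast; exact Nat.lt_floor_add_one _
  have hjup : (j : ℝ) ≤ ks / c₀ + 1 := by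
    rw [hj]; push_cast; gcongr; exact Nat.floor_le (by positivity)
  have hklow : ks < k := by
    rw [div_lt_iff₀ hc₀0] at hjlow; rw [hkdef]; linarith
  have hk0 : 0 < k := hks0.trans hklow
  have hkup : k ≤ ks + c₀ := by
    have := mul_le_mul_of_nonneg_left hjup hc₀0.le
    rw [hkdef]
    calc c₀ * j ≤ c₀ * (ks / c₀ + 1) := this
      _ = ks + c₀ := by field_simp
  have hkK : K ≤ k := (hKK'.trans (by rw [hks] at hklow; exact (le_max_left _ _).trans hklow.le))
  have hkd : η / d < k := lt_of_le_of_lt (by rw [hks]; exact le_max_right _ _) hklow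
  -- the floor's deficit at `k` is below the dip: `1 - f k ≤ η / k < d`
  have hdef : 1 - f k < d := by
    have h1 : (1 - f k) * k ≤ η := hK k hkK
    have h2 : 1 - f k ≤ η / k := by rw [le_div_iff₀ hk0]; exact h1
    have h3 : η / k < d := by
      rw [div_lt_iff₀ hk0]
      rw [div_lt_iff₀ hd0] at hkd
      linarith
    exact lt_of_le_of_lt h2 h3
  -- the energy budget: `2 ε² N³ k² ≤ δr`
  have hk2 : k ^ 2 ≤ 2 * ks ^ 2 + 2 * c₀ ^ 2 := sq_le_two_sq_add_two_sq hk0.le hkup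
  have hks2 : ks ^ 2 ≤ K' ^ 2 + (η / d) ^ 2 := by
    rw [hks]; exact max_sq_le_add_sq K' (η / d)
  have hEreal : 2 * ε ^ 2 * ((n : ℝ) + 1) ^ 3 * k ^ 2 ≤ δr := by
    rw [← hNr]
    have hx0 : 0 ≤ 2 * ε ^ 2 * Nr ^ 3 := by positivity
    have hk3 : k ^ 2 ≤ 2 * (K' ^ 2 + (η / d) ^ 2) + 2 * c₀ ^ 2 := by linarith
    have h1 : 2 * ε ^ 2 * Nr ^ 3 * k ^ 2 ≤
        2 * ε ^ 2 * Nr ^ 3 * (2 * (K' ^ 2 + (η / d) ^ 2) + 2 * c₀ ^ 2) :=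
      mul_le_mul_of_nonneg_left hk3 hx0
    have h2 : 2 * ε ^ 2 * Nr ^ 3 * (2 * (K' ^ 2 + (η / d) ^ 2) + 2 * c₀ ^ 2) =
        4 * ε ^ 2 * Nr ^ 3 * (K' ^ 2 + c₀ ^ 2) + 4 * Nr ^ 3 * (ε ^ 2 * (η / d) ^ 2) := by ring
    have h3 : ε ^ 2 * (η / d) ^ 2 = η ^ 2 / (n : ℝ) ^ 2 := by
      rw [hd]
      have hεne : ε ≠ 0 := hε0.ne'
      have hnne : (n : ℝ) ≠ 0 := hn0.ne'
      field_simp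
    have h4 : 4 * Nr ^ 3 * (ε ^ 2 * (η / d) ^ 2) = 4 * Nr ^ 3 * η ^ 2 / (n : ℝ) ^ 2 := by
      rw [h3]; ring
    linarith
  -- the witness
  refine ⟨witnessState hε0.le hεa hL hm, ?_, witnessState_real hε0.le hεa hL hm,
    witnessState_ne_zero hε0.le hεa hL hm, m, hm, ?_⟩
  · rw [periodicGroundStateEnergy_zero_eq_zero (n + 1) hL, zero_add]
    refine (periodicEnergy_witnessState_le hε0.le hεa hL hm).trans (le_trans ?_ hδr')
    refine ENNReal.ofReal_le_ofReal ?_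
    rw [hkn]
    push_cast
    exact hEreal
  · rw [structureFactor_witnessState_succ' hL n hε0.le hεa hm, hkn, ← hd]
    linarith

/-! ### The two printed floors satisfy the tail hypothesis -/

/-- The quadratic floor `k²/(k²+c)` (`c ≥ 0`) has deficit `(1 − f(k))·k ≤ c/k → 0`. [folklore] -/
theorem deficit_quadratic {c : ℝ} (hc : 0 ≤ c) :
    ∀ η : ℝ, 0 < η → ∃ K : ℝ, ∀ k : ℝ, K ≤ k → (1 - k ^ 2 / (k ^ 2 + c)) * k ≤ η := by
  intro η hη
  refine ⟨max 1 (c / η), fun k hk => ?_⟩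
  have hk1 : 1 ≤ k := (le_max_left _ _).trans hk
  have hk0 : 0 < k := by linarith
  have hkc : c / η ≤ k := (le_max_right _ _).trans hk
  have hpos : 0 < k ^ 2 + c := by positivity
  have h1 : (1 - k ^ 2 / (k ^ 2 + c)) * k = c * k / (k ^ 2 + c) := by
    field_simp
    ring
  rw [h1, div_le_iff₀ hpos]
  rw [div_le_iff₀ hη] at hkc
  nlinarith

/-- The square-root floor `k/√(k²+c)` (`c ≥ 0`) has deficit `(1 − f(k))·k ≤ c/(2k) → 0`.
[folklore] -/
theorem deficit_sqrt {c : ℝ} (hc : 0 ≤ c) :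
    ∀ η : ℝ, 0 < η → ∃ K : ℝ, ∀ k : ℝ, K ≤ k → (1 - k / Real.sqrt (k ^ 2 + c)) * k ≤ η := by
  intro η hη
  refine ⟨max 1 (c / η), fun k hk => ?_⟩
  have hk1 : 1 ≤ k := (le_max_left _ _).trans hk
  have hk0 : 0 < k := by linarith
  have hkc : c / η ≤ k := (le_max_right _ _).trans hk
  set s : ℝ := Real.sqrt (k ^ 2 + c) with hs
  have hs0 : 0 < s := Real.sqrt_pos.2 (by positivity)
  have hss : s ^ 2 = k ^ 2 + c := Real.sq_sqrt (by positivity)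
  have hks : k ≤ s := by
    rw [hs]
    calc k = Real.sqrt (k ^ 2) := (Real.sqrt_sq hk0.le).symm
      _ ≤ Real.sqrt (k ^ 2 + c) := Real.sqrt_le_sqrt (by linarith)
  -- `(1 - k/s) k = k (s - k)/s = k c /(s (s + k)) ≤ c / (2k)·... ≤ η`
  have h1 : (1 - k / s) * k = k * (s - k) / s := by field_simp
  rw [h1, div_le_iff₀ hs0]
  -- `k (s - k) ≤ η s` ⇐ `k (s - k)(s + k) = k c ≤ η s (s + k)` and `s + k > 0`
  have hsk : 0 < s + k := by linarith
  have key : k * (s - k) * (s + k) ≤ η * s * (s + k) := by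
    have e : k * (s - k) * (s + k) = k * c := by nlinarith
    rw [e]
    rw [div_le_iff₀ hη] at hkc
    nlinarith
  nlinarith

end Summit.AtomisticToContinuum.BoseEinsteinCondensation.Theorems.HardCoreExtension.Negative

end
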